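import Summits.CriticalPhenomena.SAWScalingLimit.Theorems.SAWLeftRightFKGLeftRightFKGFirstStepMonotone
import Summits.CriticalPhenomena.SAWScalingLimit.Theorems.SAWLeftRightFKGLeftRightFKGNotchThreePoint
import Summits.CriticalPhenomena.SAWScalingLimit.Theorems.SAWLeftRightFKGLeftRightFKGLadderStructureAux
import HarnessLib

/-!
# Crux `LeftRightFKG` (stmt-CriticalPhenomena-11232), line `corner-localisation` (lead c4, v9):
the two end-step events on the NOTCHED box are `≼`-up-closed (`stub_notchUpClosed`, T9d)

GEOMETRY. Sites = the open box `(x₀,x₁) × (y₀,y₁)` minus the bottom-row notch `s = (x_s, y₀+1)`; the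
discrete domain graph `(dom C 1)_1` has lattice adjacency inside that set (hypothesis `hadj`, nothing else
about `C` is used). Marked points `a = (x_s-1, y₀+1)` (bottom row) and `b = (x_s, y₀+2)`; `v = (x_s-1, y₀+2)`
is their common neighbour in the domain. Every vertex of a chord lies in `box ∖ {s}` (`support_mem`), in
particular at height `≥ y₀ + 1 = a 1`.

FIRST EVENT `{first step West of a}`: verbatim the first implication of the landed
`Families.stub_firstStepMonotone` (T2).

SECOND EVENT `{last step not from v}`. With `m = x_s - 1`, `k = y₀ + 2`, `wcross m k γ` counts the signed
crossings of the line `x = x_s - ½` at heights `≥ y₀ + 3`. FLOW CONSERVATION (`wcross_eq_flow_of_darts`,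
telescoping over darts): every lattice dart `p → q` changes the indicator `[x_s ≤ (·) 0]` by exactly its
signed crossing number UNLESS it is one of the two horizontal edges across that line at heights `y₀+1`,
`y₀+2` inside the box, namely `{a, s}` — absent, `s` is the notch — and `{v, b}` (`edgeCross_notch`). Since
`b` is the END of the self-avoiding chord, `{v, b}` can only be its last dart; so along the reversed chord
minus its first dart the count is the net flow, and the first reversed dart `b → z` contributes `0`
(`wcross_reverse_tail`). Result: `wcross (x_s-1) (y₀+2) γ = [x_s ≤ z 0]`, `z` the penultimate vertex
(`wcross_chord`), and `z ∈ {v, E_b, N_b}` (`NotchThreePoint.nbr_b`) gives `[x_s ≤ z 0] = [z ≠ v]`. Finally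
`lr γ₁ γ₂` orders the counts (`Negative.wcross_le_of_wind_nonneg` at the face centre `probeL m k`, height
ceiling read off the two supports; `wcross_le_of_lr`), so `[z₁ ≠ v] ≤ [z₂ ≠ v]`: the event passes up.
No named facts are used. [folklore]
-/

open Literature.Probability.LatticeModels Literature.Probability.RandomPlanarGeometry
open Summit.CriticalPhenomena.SAWScalingLimit.Theorems.LeftRightFKG.Negative (bx pathCross wcross)
open Summit.CriticalPhenomena.SAWScalingLimit.Theorems.LeftRightFKG.CornerLoc

namespace Summit.CriticalPhenomena.SAWScalingLimit.Theorems.LeftRightFKG.Families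

namespace NotchUpClosed

open BoxLeafThreePoint NotchThreePoint

/-! ## Crossing counts as net flows -/

section Walks

variable {G : SimpleGraph (Site 2)}

/-- Telescoping along the darts of a walk: `Σ (f snd - f fst) = f end - f start`. [folklore] -/
theorem sum_darts_telescope (f : Site 2 → ℤ) : ∀ {u v : Site 2} (w : G.Walk u v),
    (w.darts.map fun d => f d.snd - f d.fst).sum = f v - f u
  | _, _, SimpleGraph.Walk.nil => by simp
  | _, _, SimpleGraph.Walk.cons (v := v') h p => by
    rw [SimpleGraph.Walk.darts_cons, List.map_cons, List.sum_cons, sum_darts_telescope f p]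
    show f v' - f _ + _ = _
    ring

/-- FLOW CONSERVATION: if every dart of a walk changes `f` by exactly its signed crossing number, the
crossing count of the walk is the net flow `f end - f start`. [folklore] -/
theorem wcross_eq_flow_of_darts (m k : ℤ) (f : Site 2 → ℤ) {u v : Site 2} (w : G.Walk u v)
    (h : ∀ d ∈ w.darts, Negative.edgeCross m k d.fst d.snd = f d.snd - f d.fst) :
    wcross m k w = f v - f u := by
  rw [Negative.wcross_eq_darts, List.map_congr_left h, sum_darts_telescope]

/-- All vertices of a walk lie in a set `S` containing its start and closed under the adjacency of the
graph (second endpoint). [folklore] -/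
theorem support_mem {S : Set (Site 2)} (hS : ∀ p q : Site 2, G.Adj p q → q ∈ S) :
    ∀ {u v : Site 2} (w : G.Walk u v), u ∈ S → ∀ z ∈ w.support, z ∈ S
  | _, _, SimpleGraph.Walk.nil, hu, z, hz => by
    rw [SimpleGraph.Walk.support_nil, List.mem_singleton] at hz
    exact hz ▸ hu
  | _, _, SimpleGraph.Walk.cons h p, hu, z, hz => by
    rw [SimpleGraph.Walk.support_cons, List.mem_cons] at hz
    rcases hz with rfl | hz
    · exact hu
    · exact support_mem hS p (hS _ _ h) z hz

end Walks

/-! ## The notched box: darts across the line `x = x_s - ½` -/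

/-- A site different from `bx i j` has a different coordinate. [folklore] -/
theorem not_coords_of_ne {p : Site 2} {i j : ℤ} (h : p ≠ bx i j) : ¬ (p 0 = i ∧ p 1 = j) := fun hc =>
  h (by rw [Negative.eq_bx p, bx_eq_iff]; exact hc)

/-- PER-DART FLOW IDENTITY in the notched box. For a lattice dart `p → q` from a site of height `> y₀`,
neither endpoint being the notch `s = (x_s, y₀+1)` or the marked point `b = (x_s, y₀+2)`, the signed crossing
number over the line `x = x_s - ½` at heights `≥ y₀ + 3` equals the change of the indicator `[x_s ≤ (·) 0]`:
the only horizontal lattice edges across that line at heights `y₀+1`, `y₀+2` are `{a, s}` and `{v, b}`.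
[folklore] -/
theorem edgeCross_notch {x_s y₀ : ℤ} {p q : Site 2} (h : (zdGraph 2).Adj p q) (hp : y₀ < p 1)
    (hps : ¬ (p 0 = x_s ∧ p 1 = y₀ + 1)) (hqs : ¬ (q 0 = x_s ∧ q 1 = y₀ + 1))
    (hpb : ¬ (p 0 = x_s ∧ p 1 = y₀ + 2)) (hqb : ¬ (q 0 = x_s ∧ q 1 = y₀ + 2)) :
    Negative.edgeCross (x_s - 1) (y₀ + 2) p q =
      (if x_s ≤ q 0 then 1 else 0) - (if x_s ≤ p 0 then 1 else 0) := by
  have hc := Negative.adj_cases h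
  unfold Negative.edgeCross
  split_ifs <;> omega

/-- A dart leaving `b = (x_s, y₀+2)` is not counted at level `y₀ + 2` (horizontal edges at `b` have height
`y₀ + 2 < y₀ + 3`; vertical edges never count). [folklore] -/
theorem edgeCross_from_b (x_s y₀ : ℤ) (q : Site 2) :
    Negative.edgeCross (x_s - 1) (y₀ + 2) (bx x_s (y₀ + 2)) q = 0 := by
  unfold Negative.edgeCross
  simp only [Negative.bx_zero, Negative.bx_one]
  split_ifs <;> omega

section Notch

variable {Ω : Set ℂ} {x₀ x₁ y₀ y₁ x_s : ℤ}

/-- THE REVERSED-CHORD CROSSING FORMULA. For a self-avoiding walk `w` of the notched-box graph starting at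
`b = (x_s, y₀+2)` and ending at `u ≠ b`: `wcross (x_s-1) (y₀+2) w = [x_s ≤ u 0] - [x_s ≤ (w 1) 0]` — the first
dart leaves `b` and is not counted (`Ladder.wcross_cons`, `edgeCross_from_b`), the remaining walk avoids `b`
(self-avoidance) and the notch (not a site), so every one of its darts obeys the per-dart flow identity
(`edgeCross_notch`). [folklore] -/
theorem wcross_reverse_tail
    (hadj : ∀ p q : Site 2, (discreteDomainGraph Ω 1).Adj p q ↔
      (zdGraph 2).Adj p q ∧ p ∈ Negative.Rect.box x₀ x₁ y₀ y₁ \ {bx x_s (y₀ + 1)} ∧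
        q ∈ Negative.Rect.box x₀ x₁ y₀ y₁ \ {bx x_s (y₀ + 1)})
    {u : Site 2} (w : (discreteDomainGraph Ω 1).Walk (bx x_s (y₀ + 2)) u) (hw : w.IsPath)
    (hu : bx x_s (y₀ + 2) ≠ u) :
    wcross (x_s - 1) (y₀ + 2) w = (if x_s ≤ u 0 then 1 else 0) - (if x_s ≤ (w.getVert 1) 0 then 1 else 0) := by
  cases w with
  | nil => exact absurd rfl hu
  | cons h q =>
    rw [SimpleGraph.Walk.cons_isPath_iff] at hw
    rw [Ladder.wcross_cons, SimpleGraph.Walk.getVert_cons_succ, SimpleGraph.Walk.getVert_zero,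
      edgeCross_from_b, zero_add]
    refine wcross_eq_flow_of_darts (x_s - 1) (y₀ + 2) (fun p : Site 2 => if x_s ≤ p 0 then (1 : ℤ) else 0) q
      fun d hd => ?_
    obtain ⟨hl, ⟨hp, hps⟩, ⟨-, hqs⟩⟩ := (hadj _ _).1 d.adj
    have h1 : d.fst ≠ bx x_s (y₀ + 2) := fun e => hw.2 (e ▸ q.dart_fst_mem_support_of_mem_darts hd)
    have h2 : d.snd ≠ bx x_s (y₀ + 2) := fun e => hw.2 (e ▸ q.dart_snd_mem_support_of_mem_darts hd)
    exact edgeCross_notch hl hp.2.1 (not_coords_of_ne hps) (not_coords_of_ne hqs) (not_coords_of_ne h1)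
      (not_coords_of_ne h2)

/-- THE CHORD CROSSING FORMULA on the notched box: for a chord `γ : a → b`, `a = (x_s-1, y₀+1)`,
`b = (x_s, y₀+2)`, the crossing count over the line `x = x_s - ½` at heights `≥ y₀ + 3` is
`[x_s ≤ z 0]`, `z` the penultimate vertex (`wcross_reverse_tail` for the reversed chord,
`Negative.wcross_reverse`). [folklore] -/
theorem wcross_chord
    (hadj : ∀ p q : Site 2, (discreteDomainGraph Ω 1).Adj p q ↔
      (zdGraph 2).Adj p q ∧ p ∈ Negative.Rect.box x₀ x₁ y₀ y₁ \ {bx x_s (y₀ + 1)} ∧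
        q ∈ Negative.Rect.box x₀ x₁ y₀ y₁ \ {bx x_s (y₀ + 1)})
    (γ : SAW.DomainSAW Ω 1 (bx (x_s - 1) (y₀ + 1)) (bx x_s (y₀ + 2))) :
    wcross (x_s - 1) (y₀ + 2) γ.walk = if x_s ≤ (γ.walk.reverse.getVert 1) 0 then 1 else 0 := by
  have hba : bx x_s (y₀ + 2) ≠ bx (x_s - 1) (y₀ + 1) := fun e => by
    rw [bx_eq_iff] at e
    omega
  have key := wcross_reverse_tail hadj γ.walk.reverse ((SimpleGraph.Walk.isPath_reverse_iff _).2 γ.isPath)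
    hba
  rw [Negative.wcross_reverse, Negative.bx_zero, if_neg (show ¬ (x_s ≤ x_s - 1) by omega), zero_sub,
    neg_inj] at key
  exact key

/-- `lr γ₁ γ₂` forces `wcross m k γ₁ ≤ wcross m k γ₂` at every face `(m, k)` — in every domain
(`δ = 1`): `Negative.wcross_le_of_wind_nonneg` with the height ceiling read off the two finite
supports (pattern of the landed `Families.stub_firstStepMonotone`). [folklore] -/
theorem wcross_le_of_lr {a b : Site 2} (γ₁ γ₂ : SAW.DomainSAW Ω 1 a b) (h : lr γ₁ γ₂) (m k : ℤ) :
    wcross m k γ₁.walk ≤ wcross m k γ₂.walk := by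
  have hG : ∀ x y, (discreteDomainGraph Ω 1).Adj x y → (zdGraph 2).Adj x y := fun x y hxy =>
    meshGraph_le_zdGraph Ω 1 (discreteDomainGraph_le_meshGraph Ω 1 hxy)
  classical
  obtain ⟨Y, hY⟩ := Finset.exists_le
    (insert k (((γ₁.walk.support ++ γ₂.walk.support).map fun x : Site 2 => x 1).toFinset))
  have hkY : k ≤ Y := hY k (Finset.mem_insert_self _ _)
  have hs : ∀ x ∈ γ₁.walk.support ++ γ₂.walk.support, x 1 ≤ Y := fun x hx =>
    hY (x 1) (Finset.mem_insert_of_mem (List.mem_toFinset.2 (List.mem_map.2 ⟨x, hx, rfl⟩)))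
  exact Negative.wcross_le_of_wind_nonneg hG γ₁.walk γ₂.walk hkY
    (fun x hx => hs x (List.mem_append_left _ hx))
    (fun x hx => hs x (List.mem_append_right _ hx)) (h (Negative.probeL m k))

/-- Every vertex of a chord of the notched box lies in `box ∖ {s}` (`support_mem` from `a ∈ box ∖ {s}`).
[folklore] -/
theorem support_mem_notched
    (hadj : ∀ p q : Site 2, (discreteDomainGraph Ω 1).Adj p q ↔
      (zdGraph 2).Adj p q ∧ p ∈ Negative.Rect.box x₀ x₁ y₀ y₁ \ {bx x_s (y₀ + 1)} ∧
        q ∈ Negative.Rect.box x₀ x₁ y₀ y₁ \ {bx x_s (y₀ + 1)})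
    (h₁ : x₀ + 2 < x_s) (h₂ : x_s + 1 < x₁) (h₃ : y₀ + 3 < y₁)
    (γ : SAW.DomainSAW Ω 1 (bx (x_s - 1) (y₀ + 1)) (bx x_s (y₀ + 2))) :
    ∀ z ∈ γ.walk.support, z ∈ Negative.Rect.box x₀ x₁ y₀ y₁ \ {bx x_s (y₀ + 1)} :=
  support_mem (fun p q hpq => ((hadj p q).1 hpq).2.2) γ.walk (bx_mem_notched (by omega))

/-- The penultimate vertex `z` of a chord of the notched box is a domain neighbour of `b`: `z → b` is a
lattice edge and `z ∈ box ∖ {s}`. [folklore] -/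
theorem penultimate_adj
    (hadj : ∀ p q : Site 2, (discreteDomainGraph Ω 1).Adj p q ↔
      (zdGraph 2).Adj p q ∧ p ∈ Negative.Rect.box x₀ x₁ y₀ y₁ \ {bx x_s (y₀ + 1)} ∧
        q ∈ Negative.Rect.box x₀ x₁ y₀ y₁ \ {bx x_s (y₀ + 1)})
    (γ : SAW.DomainSAW Ω 1 (bx (x_s - 1) (y₀ + 1)) (bx x_s (y₀ + 2))) :
    (zdGraph 2).Adj (γ.walk.reverse.getVert 1) (bx x_s (y₀ + 2)) ∧
      γ.walk.reverse.getVert 1 ∈ Negative.Rect.box x₀ x₁ y₀ y₁ \ {bx x_s (y₀ + 1)} := by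
  have hab : bx (x_s - 1) (y₀ + 1) ≠ bx x_s (y₀ + 2) := fun e => by
    rw [bx_eq_iff] at e
    omega
  have hlen : 0 < γ.walk.reverse.length := by
    rw [SimpleGraph.Walk.length_reverse]
    exact Nat.pos_of_ne_zero fun h0 => hab (γ.walk.eq_of_length_eq_zero h0)
  have h := γ.walk.reverse.adj_getVert_succ (i := 0) hlen
  rw [SimpleGraph.Walk.getVert_zero] at h
  obtain ⟨hl, -, hz⟩ := (hadj _ _).1 h
  exact ⟨hl.symm, hz⟩

end Notch

end NotchUpClosed

open BoxLeafThreePoint NotchThreePoint NotchUpClosed in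
/-- STUB T9d `stub_notchUpClosed` of line `corner-localisation` (crux `LeftRightFKG`,
stmt-CriticalPhenomena-11232): on the NOTCHED box (sites = open box minus the bottom-row notch
`s = (x_s, y₀+1)`, adjacency of `(dom C 1)_1` = lattice adjacency inside that set — T9b's conclusion as the
hypothesis `hadj`), with marked points `a = (x_s-1, y₀+1)`, `b = (x_s, y₀+2)`, the two end-step events are
`≼`-UP-CLOSED: `{first step West}` at the bottom-row point `a` by the landed T2
(`Families.stub_firstStepMonotone`; all chord vertices have height `≥ a 1`), and `{last step not from v}`,
`v = (x_s-1, y₀+2)`, because `wcross (x_s-1) (y₀+2) γ = [last step not from v]` (`wcross_chord`: the edge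
`{a, s}` is missing, so `v → b` is the only possible dart of a chord across the line `x = x_s - ½` at height
`≤ y₀ + 2`, and it is not counted) while `lr` orders these counts (`wcross_le_of_lr`). [folklore] -/
theorem stub_notchUpClosed : ∀ (x₀ x₁ y₀ y₁ x_s : ℤ) (C : (zdGraph 2).Walk (bx x₀ y₀) (bx x₀ y₀)),
    x₀ + 2 < x_s → x_s + 1 < x₁ → y₀ + 3 < y₁ →
    (∀ u w : Site 2, (discreteDomainGraph (dom C 1) 1).Adj u w ↔
      (zdGraph 2).Adj u w ∧ u ∈ Negative.Rect.box x₀ x₁ y₀ y₁ \ {bx x_s (y₀ + 1)} ∧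
        w ∈ Negative.Rect.box x₀ x₁ y₀ y₁ \ {bx x_s (y₀ + 1)}) →
    IsUp ({γ | γ.walk.getVert 1 = bx (x_s - 2) (y₀ + 1)} :
        Set (SAW.DomainSAW (dom C 1) 1 (bx (x_s - 1) (y₀ + 1)) (bx x_s (y₀ + 2)))) ∧
    IsUp ({γ | γ.walk.reverse.getVert 1 ≠ bx (x_s - 1) (y₀ + 2)} :
        Set (SAW.DomainSAW (dom C 1) 1 (bx (x_s - 1) (y₀ + 1)) (bx x_s (y₀ + 2)))) := by
  intro x₀ x₁ y₀ y₁ x_s C h₁ h₂ h₃ hadj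
  have hab : bx (x_s - 1) (y₀ + 1) ≠ bx x_s (y₀ + 2) := fun e => by
    rw [bx_eq_iff] at e
    omega
  have hY : ∀ γ : SAW.DomainSAW (dom C 1) 1 (bx (x_s - 1) (y₀ + 1)) (bx x_s (y₀ + 2)),
      ∀ z ∈ γ.walk.support, (bx (x_s - 1) (y₀ + 1)) 1 ≤ z 1 := fun γ z hz => by
    have hz' := (support_mem_notched hadj h₁ h₂ h₃ γ z hz).1.2.1
    rw [Negative.bx_one]
    omega
  refine ⟨?_, ?_⟩
  · intro γ₁ γ₂ hlr hγ₁
    have key := ((stub_firstStepMonotone _ _ _ γ₁ γ₂ hab hlr).1 (hY γ₁) (hY γ₂)).1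
    have e : bx ((bx (x_s - 1) (y₀ + 1)) 0 - 1) ((bx (x_s - 1) (y₀ + 1)) 1) = bx (x_s - 2) (y₀ + 1) := by
      rw [Negative.bx_zero, Negative.bx_one, bx_eq_iff]
      omega
    rw [e] at key
    exact key hγ₁
  · intro γ₁ γ₂ hlr hγ₁
    simp only [Set.mem_setOf_eq] at hγ₁ ⊢
    have H := wcross_le_of_lr γ₁ γ₂ hlr (x_s - 1) (y₀ + 2)
    rw [wcross_chord hadj γ₁, wcross_chord hadj γ₂] at H
    have hz₁ : x_s ≤ (γ₁.walk.reverse.getVert 1) 0 := by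
      obtain ⟨hl, hz⟩ := penultimate_adj hadj γ₁
      rcases nbr_b hl hz rfl rfl with e | e | e
      · exact absurd e hγ₁
      · rw [e, Negative.bx_zero]
        omega
      · rw [e, Negative.bx_zero]
    intro e
    rw [e, Negative.bx_zero, if_pos hz₁, if_neg (show ¬ (x_s ≤ x_s - 1) by omega)] at H
    exact absurd H (by norm_num)

end Summit.CriticalPhenomena.SAWScalingLimit.Theorems.LeftRightFKG.Families
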